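import Literature.Geometry.Kaehler.AnalyticSet
import HarnessLib

/-!
# Regular points of analytic sets under holomorphic submersions and biholomorphisms

Small complements to `Literature/Geometry/Kaehler/AnalyticSet.lean` ([Chirka1989, §2.3]): the
predicates `Literature.Geometry.Kaehler.IsAnalyticSet`, `IsRegularPointOfCodim`, `regularLocus`
are transported along holomorphic maps.

* `IsRegularPointOfCodim.preimage` — if `g : M → M'` is holomorphic with surjective differential
  at `x` and `g x` is a regular point of codimension `q` of `Z ⊆ M'`, then `x` is a regular point
  of codimension `q` of `g ⁻¹' Z` (pull back the defining submersion; chain rule). (The companion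
  statement for `IsAnalyticSet` is `IsAnalyticSet.preimage` in `AnalyticSet.lean`.)
* `surjective_mfderiv_apply_symm` — the differential of a biholomorphism `h : M ≃ₜ M'`
  (holomorphic with holomorphic inverse) is onto at every point (`dh ∘ dh⁻¹ = id`).
* `IsRegularPointOfCodim.of_preimage_homeomorph`, `mem_regularLocus_of_preimage_homeomorph`,
  `forall_regularLocus_preimage_le` — along a biholomorphism `h`, regular points of `h ⁻¹' Z` of
  codimension `q` go to regular points of `Z` of codimension `q`; hence a lower bound on the
  codimension at regular points of `Z` is inherited by `h ⁻¹' Z`.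

Consumer: independence of the Hodge model in
`Literature/AlgebraicGeometry/HodgeTheory/AnalyticSupport.lean` (two Hodge models of a smooth
projective variety are biholomorphic over `X(ℂ)`). Theorems only; no definitions, no named facts.

## References

* E. M. Chirka, *Complex Analytic Sets*, Kluwer (1989), §2.3 (regular points; invariance under
  biholomorphic maps) [Chirka1989].
-/

open scoped Manifold ContDiff Topology
open Set Filter

namespace Literature.Geometry.Kaehler

variable {E : Type*} [NormedAddCommGroup E] [NormedSpace ℂ E]
  {H : Type*} [TopologicalSpace H] {I : ModelWithCorners ℂ E H}
  {M : Type*} [TopologicalSpace M] [ChartedSpace H M]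
  {E' : Type*} [NormedAddCommGroup E'] [NormedSpace ℂ E']
  {H' : Type*} [TopologicalSpace H'] {I' : ModelWithCorners ℂ E' H'}
  {M' : Type*} [TopologicalSpace M'] [ChartedSpace H' M']

/-- **Regular points pull back along holomorphic maps with surjective differential.** If
`g : M → M'` is holomorphic, `dg(x)` is onto, and `g x` is a regular point of codimension `q` of
`Z ⊆ M'` (cut out near `g x` by a submersion `f` to `ℂ^q`), then `x` is a regular point of
codimension `q` of `g ⁻¹' Z` (cut out near `x` by the submersion `f ∘ g`).
[Chirka, *Complex Analytic Sets*, §2.3] [folklore] -/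
theorem IsRegularPointOfCodim.preimage {Z : Set M'} {q : ℕ} {g : M → M'} {x : M}
    (h : IsRegularPointOfCodim I' Z q (g x)) (hg : MDifferentiable I I' g)
    (hsurj : Function.Surjective (mfderiv I I' g x)) :
    IsRegularPointOfCodim I (g ⁻¹' Z) q x := by
  obtain ⟨U, hU, hxU, f, hf, hZU, hfs⟩ := h
  refine ⟨g ⁻¹' U, hU.preimage hg.continuous, hxU, f ∘ g,
    hf.comp hg.mdifferentiableOn (mapsTo_preimage g U), ?_, ?_⟩
  · rw [← preimage_inter, hZU, preimage_inter, preimage_comp]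
  · have hcomp : mfderiv I 𝓘(ℂ, Fin q → ℂ) (f ∘ g) x =
        (mfderiv I' 𝓘(ℂ, Fin q → ℂ) f (g x)).comp (mfderiv I I' g x) :=
      mfderiv_comp x (hf.mdifferentiableAt (hU.mem_nhds hxU)) (hg x)
    intro w
    obtain ⟨v, hv⟩ := hfs w
    obtain ⟨u, hu⟩ := hsurj v
    refine ⟨u, (DFunLike.congr_fun hcomp u).trans ?_⟩
    change mfderiv I' 𝓘(ℂ, Fin q → ℂ) f (g x) (mfderiv I I' g x u) = w
    rw [hu, hv]

/-- **The differential of a biholomorphism is onto**: if `h : M ≃ₜ M'` is holomorphic with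
holomorphic inverse, then `dh` is surjective at every point `h.symm y` (from
`dh ∘ d(h⁻¹) = d(h ∘ h⁻¹) = id` at `y`). [folklore] -/
theorem surjective_mfderiv_apply_symm (h : M ≃ₜ M') (hh : MDifferentiable I I' h)
    (hh' : MDifferentiable I' I h.symm) (y : M') :
    Function.Surjective (mfderiv I I' h (h.symm y)) := by
  intro w
  have h1 := mfderiv_comp y (hh (h.symm y)) (hh' y)
  rw [Homeomorph.self_comp_symm, mfderiv_id] at h1
  refine ⟨mfderiv I' I h.symm y w, ?_⟩
  have h2 := DFunLike.congr_fun h1 w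
  exact h2.symm

/-- The differential of a biholomorphism `h : M ≃ₜ M'` is onto at every point of `M`.
[folklore] -/
theorem surjective_mfderiv_of_homeomorph (h : M ≃ₜ M') (hh : MDifferentiable I I' h)
    (hh' : MDifferentiable I' I h.symm) (x : M) :
    Function.Surjective (mfderiv I I' h x) := by
  have := surjective_mfderiv_apply_symm h hh hh' (h x)
  rwa [Homeomorph.symm_apply_apply] at this

/-- **Regular points are invariant under biholomorphisms.** If `h : M ≃ₜ M'` is holomorphic with
holomorphic inverse and `x` is a regular point of codimension `q` of `h ⁻¹' Z`, then `h x` is a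
regular point of codimension `q` of `Z` (apply `IsRegularPointOfCodim.preimage` to `h⁻¹` at `h x`,
using `h.symm ⁻¹' (h ⁻¹' Z) = Z`). [Chirka, *Complex Analytic Sets*, §2.3] [folklore] -/
theorem IsRegularPointOfCodim.of_preimage_homeomorph (h : M ≃ₜ M') (hh : MDifferentiable I I' h)
    (hh' : MDifferentiable I' I h.symm) {Z : Set M'} {q : ℕ} {x : M}
    (hx : IsRegularPointOfCodim I (h ⁻¹' Z) q x) : IsRegularPointOfCodim I' Z q (h x) := by
  have hx' : IsRegularPointOfCodim I (h ⁻¹' Z) q (h.symm (h x)) := by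
    rwa [Homeomorph.symm_apply_apply]
  have hs : Function.Surjective (mfderiv I' I h.symm (h x)) :=
    surjective_mfderiv_apply_symm h.symm hh' hh x
  have hpre : h.symm ⁻¹' (h ⁻¹' Z) = Z := by
    ext z
    simp
  have := hx'.preimage hh' hs
  rwa [hpre] at this

/-- Along a biholomorphism `h`, points of the regular locus of `h ⁻¹' Z` go to the regular locus of
`Z`. [Chirka, *Complex Analytic Sets*, §2.3] [folklore] -/
theorem mem_regularLocus_of_preimage_homeomorph (h : M ≃ₜ M') (hh : MDifferentiable I I' h)
    (hh' : MDifferentiable I' I h.symm) {Z : Set M'} {x : M} (hx : x ∈ regularLocus I (h ⁻¹' Z)) :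
    h x ∈ regularLocus I' Z := by
  obtain ⟨hxZ, q, hq⟩ := hx
  exact ⟨hxZ, q, hq.of_preimage_homeomorph h hh hh'⟩

/-- **Lower bounds on the codimension are invariant under biholomorphisms**: if every regular
point of `Z ⊆ M'` has codimension `≥ p` and `h : M ≃ₜ M'` is a biholomorphism, then every regular
point of `h ⁻¹' Z ⊆ M` has codimension `≥ p`. [Chirka, *Complex Analytic Sets*, §2.3] [folklore] -/
theorem forall_regularLocus_preimage_le (h : M ≃ₜ M') (hh : MDifferentiable I I' h)
    (hh' : MDifferentiable I' I h.symm) {Z : Set M'} {p : ℕ}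
    (hp : ∀ y ∈ regularLocus I' Z, ∀ q : ℕ, IsRegularPointOfCodim I' Z q y → p ≤ q) :
    ∀ x ∈ regularLocus I (h ⁻¹' Z), ∀ q : ℕ, IsRegularPointOfCodim I (h ⁻¹' Z) q x → p ≤ q :=
  fun x hx q hq => hp (h x) (mem_regularLocus_of_preimage_homeomorph h hh hh' hx) q
    (hq.of_preimage_homeomorph h hh hh')

/-- Analytic sets pull back to analytic sets along a biholomorphism, with the image description
`h ⁻¹' Z = h.symm '' Z`. (The pull-back statement for arbitrary holomorphic maps is
`IsAnalyticSet.preimage`.) [Chirka, *Complex Analytic Sets*, §2.3] [folklore] -/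
theorem IsAnalyticSet.image_symm_homeomorph (h : M ≃ₜ M') (hh : MDifferentiable I I' h)
    {Z : Set M'} (hZ : IsAnalyticSet I' Z) : IsAnalyticSet I (h.symm '' Z) := by
  rw [← Homeomorph.preimage_symm, Homeomorph.symm_symm]
  exact hZ.preimage hh

end Literature.Geometry.Kaehler
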